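import Mathlib.Order.Closure
import Mathlib.Algebra.Group.Action.Pointwise.Set.Basic
import Mathlib.Algebra.Group.Action.End
import Mathlib.Data.Real.Basic
import HarnessLib

/-!
# The fork at [IUTchIII] Corollary 3.12, XXIId: (Ind1) ACTIVE vs PASSIVE — why the Step (xi) reading decides it

Record-only file (D-0012) of the abc-iut cell's fork skeleton (seat abc-iut-skel); TAKES NO SIDE. Skeleton
XXII (`ForkInd1`) types the two readings of (Ind1) at [IUTchIV] Thm. 1.10 Step (v): (U) the hull of the UNION
of the label-permuted Θ-regions, (S) the hull of ONE labelled region, its volume being label-independent.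
This file isolates the one piece of set algebra behind the choice, over an abstract container: a type `X`
with a group `G` acting ("relabellings": [IUTchIII] Thm. 3.11 (i), (Ind1) = "the indeterminacies induced by
the automorphisms of the procession of `D⊢`-prime-strips"), a closure operator `hull` (Rmk. 3.9.5 (i)), a
monotone log-volume `vol`, and a region `R` (the Θ-pilot region in ONE labelling; the true labelling relative
to the `(1,0)`-packet is some unknown `g₀ ∈ G`).

* ACTIVE quantity `activeVol := vol (hull (⋃ g, g • R))` — the possible images "subject to (Ind1)" thrown into
  one container (reading (U); c312-1 `LogShells.Ind1` ⊆ c312-7 `indGroup` ⊆ `possibleImages`).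
* PASSIVE quantity `passiveVol := vol (hull R)` — the label-invariant number (reading (S)); under
  `G`-equivariance of `hull` and `G`-invariance of `vol` it is the same for every labelling
  (`passiveVol_smul`), and `passiveVol ≤ activeVol` (`passiveVol_le_activeVol`).
* WHY THE USE DECIDES: a container `S` is CERTIFIED to contain the Θ-region whatever the unknown labelling
  `g₀` is iff it contains the union (`certified_iff`); hence a SET-LEVEL use of Step (xi) — "`Q ⊆` (the hull
  of) the possible images" in the `(1,0)`-packet, skel XVII `QSubHull`/`QIsImage` — can only be certified
  against containers of volume `≥ activeVol` (`setLevel_forces_active`), whereas a VOLUME-LEVEL use — "the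
  `q`-pilot log-volume is (at most) a possible output log-volume", skel XVII `RepresentedVol`, LANA (9-1),
  (xi-g) "two tautologically equivalent ways to compute the log-volume" — is a statement about the number
  `passiveVol`, certified without knowing `g₀` (`volumeLevel_passive`).

So, in the kernel: the new fork (R3 of the STEPV-IND1-NOTE: (U) vs (S)) is downstream of the old one (the
reading of Step (xi)): set-level ⟹ (U) (RISK 7 bites for `d_mod > 1`, XXII/XXIIc), volume-level ⟹ (S)
available (Step (v) as printed). [claim: Mochizuki2012, status: disputed] ([IUTchIII] Thm. 3.11 (i) (Ind1)
p. 154; Cor. 3.12 pp. 173–174; Step (xi) pp. 181–185) [cite: LANA2026Report, §9.2 (9-1) p. 46]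
Deliberately NOT here: volumes of tensor packets (campaign S / c312-d1), which reading is intended (R3).
-/

noncomputable section

open scoped Pointwise

namespace Summit.ABC.IUTFork.Ind1Passive

variable {G X : Type} [Group G] [MulAction G X]

/-- The data of the question: relabellings `G` acting on the container `X`, a hull (closure operator), a
log-volume, the Θ-region `R` in one labelling; `hull` is `G`-equivariant and `vol` is `G`-invariant and
monotone (log-volumes of (Ind1)-translates agree: [IUTchIV] Step (v) "(Ind1) and (Ind2) are taken into
account by the arbitrary nature of the automorphism "`φ`""; c312-3 `lnνL_ind1`). [claim: Mochizuki2012, status: disputed] -/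
structure Setting (G X : Type) [Group G] [MulAction G X] where
  /-- the holomorphic hull on regions of the container -/
  hull : ClosureOperator (Set X)
  /-- the log-volume of a region -/
  vol : Set X → ℝ
  /-- the Θ-pilot region in ONE labelling -/
  R : Set X
  /-- `vol` is monotone -/
  vol_mono : ∀ ⦃A B : Set X⦄, A ⊆ B → vol A ≤ vol B
  /-- `vol` is invariant under relabelling -/
  vol_smul : ∀ (g : G) (A : Set X), vol (g • A) = vol A
  /-- `hull` is equivariant under relabelling -/
  hull_smul : ∀ (g : G) (A : Set X), hull (g • A) = g • hull A

namespace Setting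

variable (S : Setting G X)

/-- **ACTIVE** (reading (U)): the log-volume of the hull of the UNION of all relabelled Θ-regions — Cor.
3.12's "holomorphic hull of the union of the possible images … subject to (Ind1)" read inside one labelled
container. [claim: Mochizuki2012, status: disputed] -/
def activeVol : ℝ := S.vol (S.hull (⋃ g : G, g • S.R))

/-- **PASSIVE** (reading (S)): the log-volume of the hull of the Θ-region in one labelling — a number that
does not depend on the labelling (`passiveVol_smul`). [claim: Mochizuki2012, status: disputed] -/
def passiveVol : ℝ := S.vol (S.hull S.R)

/-- The passive quantity is LABEL-INDEPENDENT: every relabelled region has the same hull-volume.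
[folklore] -/
theorem passiveVol_smul (g : G) : S.vol (S.hull (g • S.R)) = S.passiveVol := by
  unfold passiveVol
  rw [S.hull_smul, S.vol_smul]

/-- Passive ≤ active (the union contains the region: `1 • R = R`). [folklore] -/
theorem passiveVol_le_activeVol : S.passiveVol ≤ S.activeVol := by
  unfold passiveVol activeVol
  refine S.vol_mono (S.hull.monotone ?_)
  intro x hx
  exact Set.mem_iUnion.2 ⟨1, by simpa using hx⟩

/-- If the hull of the region is itself stable under relabelling (e.g. one place of `F_mod` over `v_ℚ`: the
slot-twists coincide), active = passive. [folklore] -/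
theorem activeVol_eq_passiveVol_of_invariant (h : ∀ g : G, g • S.R ⊆ S.hull S.R) :
    S.activeVol = S.passiveVol := by
  refine le_antisymm ?_ S.passiveVol_le_activeVol
  unfold activeVol passiveVol
  refine S.vol_mono ?_
  have : (⋃ g : G, g • S.R) ⊆ S.hull S.R := Set.iUnion_subset h
  simpa [S.hull.idempotent] using S.hull.monotone this

/-! ## Why the use decides -/

/-- A container `C` is **certified** to contain the Θ-region WHATEVER the unknown relative labelling `g₀` is
iff it contains the union of all relabelled regions. [folklore] -/
theorem certified_iff (C : Set X) : (∀ g₀ : G, g₀ • S.R ⊆ C) ↔ (⋃ g : G, g • S.R) ⊆ C :=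
  Set.iUnion_subset_iff.symm

/-- **Set-level use forces ACTIVE.** If Step (xi) is used as a CONTAINMENT in the labelled `(1,0)`-packet —
the `q`-pilot image `Q` lies in a hull-set `C` certified to contain the Θ-pilot's possible images whatever
the labelling — then the comparison volume is at least the active quantity: `vol C ≥ activeVol`, so the
inequality obtained, `vol Q ≤ vol C`, is no better than `vol Q ≤ activeVol`. [folklore] -/
theorem setLevel_forces_active {C Q : Set X} (hC : S.hull C = C) (hcert : ∀ g₀ : G, g₀ • S.R ⊆ C)
    (hQ : Q ⊆ C) : S.vol Q ≤ S.vol C ∧ S.activeVol ≤ S.vol C := by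
  refine ⟨S.vol_mono hQ, ?_⟩
  unfold activeVol
  have h : S.hull (⋃ g : G, g • S.R) ≤ S.hull C := S.hull.monotone ((S.certified_iff C).1 hcert)
  rw [hC] at h
  exact S.vol_mono h

/-- **Volume-level use allows PASSIVE.** If Step (xi) is used as a statement about NUMBERS — the `q`-pilot
log-volume is at most the hull-volume of the Θ-pilot region in its (unknown) true labelling `g₀` — then,
that number being label-independent, the inequality obtained is `vol Q ≤ passiveVol`, whatever `g₀` is.
[folklore] -/
theorem volumeLevel_passive {Q : Set X} (g₀ : G) (h : S.vol Q ≤ S.vol (S.hull (g₀ • S.R))) :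
    S.vol Q ≤ S.passiveVol := by
  rwa [S.passiveVol_smul] at h

/-- **The link, side by side** (no side taken): passive ≤ active; set-level certification can only use
containers of volume ≥ active; volume-level statements land on passive. Which use Step (xi) makes is the
reading question of skel XVII (`QSubHull`/`QIsImage` vs `RepresentedVol`); XXII's (U)/(S) follows.
[claim: Mochizuki2012, status: disputed] -/
theorem link {C Q : Set X} (hC : S.hull C = C) (hcert : ∀ g₀ : G, g₀ • S.R ⊆ C) (hQ : Q ⊆ C) (g₀ : G) :
    S.passiveVol ≤ S.activeVol ∧ S.activeVol ≤ S.vol C ∧ S.vol Q ≤ S.vol C ∧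
      (S.vol Q ≤ S.vol (S.hull (g₀ • S.R)) → S.vol Q ≤ S.passiveVol) :=
  ⟨S.passiveVol_le_activeVol, (S.setLevel_forces_active hC hcert hQ).2,
    (S.setLevel_forces_active hC hcert hQ).1, S.volumeLevel_passive g₀⟩

end Setting

/-- Non-vacuity: the permutations of a one-point container, identity hull, zero volume form a `Setting`.
[folklore] -/
def trivialSetting : Setting (Equiv.Perm Unit) Unit where
  hull := ClosureOperator.id (Set Unit)
  vol := fun _ => 0
  R := Set.univ
  vol_mono := fun _ _ _ => le_rfl
  vol_smul := fun _ _ => rfl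
  hull_smul := fun _ _ => rfl

end Summit.ABC.IUTFork.Ind1Passive

end
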